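import Mathlib
import Literature.Combinatorics.Additive.TripleProductProperty
import Summits.MatrixMultiplication.MatrixMultiplication.Theses.SnSubsetDichotomy
import Summits.MatrixMultiplication.MatrixMultiplication.Theorems.ThresholdSubsetTriples.Negative.Packing
import Summits.MatrixMultiplication.MatrixMultiplication.Theorems.SnSubsetDichotomyThresholdSubsetTriplesChainDefs
import Summits.MatrixMultiplication.MatrixMultiplication.Theorems.SnSubsetDichotomyThresholdSubsetTriplesStubCard
import Summits.MatrixMultiplication.MatrixMultiplication.Theorems.SnSubsetDichotomyThresholdSubsetTriplesStubPush

/-!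
# `SnSubsetDichotomy.ThresholdSubsetTriples`, line `interleaved-subsignature-ascent` — what the open stub
# `stub_design` reduces to (siege k11: "reduce to landed lemmas of this crux, then assemble")

Crux `stmt-MatrixMultiplication-10882` (`ThresholdSubsetTriples`, the target of route `SnSubsetDichotomy`), line
`interleaved-subsignature-ascent`, skeleton `Cruxes/ThresholdSubsetTriples/Lines/interleaved_subsignature_ascent.lean`
(sha `254d7bf8fc8d`, one `sorry`: the registered stub `stub_design`).  Its statement, called `DESIGN` below, is

  `∀ c > 0, ∀ n₀, ∃ n ≥ n₀, ∃ DA DB DC` direction systems on `n+1` points with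
  `LevelCondition (last) (DA last) (DB last) (DC last) (subsigBelow DA n) (subsigBelow DB n) (subsigBelow DC n)` and
  `((n+1)!)^{3/2} · e^{-c√(n+1)} < ∏_k |DA k|·|DB k|·|DC k|`.

This file ASSEMBLES the landed lemmas of the crux — `stub_push` (token elimination, p97162), `stub_card` (exact
size, p96986), `subsig_succ` / `subsigBelow_apply_last` (vocabulary, p96122), the packing theorem
`dichotomyInduction_card_le_rpow` and `Negative.matrixMultiplication_of_thresholdSubsetTriples` (p83440) — into the
exact logical position of the stub.  Everything is sorry-free; nothing here claims `DESIGN`.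

* `chainTPP_iff_levelCondition`, `chainVolume_eq`: for direction systems the level condition at the top token IS
  the triple product property of the three chain classes `subsig D_X`, and the level volume IS `|S_A||S_B||S_C|`.
* `design_iff_chainThreshold`: hence `DESIGN` is *verbatim equivalent* to "threshold TPP triples of CHAIN CLASSES
  exist cofinally for every `c > 0`" — the crux restricted to one family of subsets, not a weaker sub-goal.
* `thresholdSubsetTriples_of_design`, `matrixMultiplication_of_design`: `DESIGN → ThresholdSubsetTriples → ω(ℂ) = 2`
  (the second arrow is the route's proved `closes` with the proved Vershik–Kerov bound).  So the only direction in
  which the landed lemmas compose is CRUX ← STUB: a proof of `stub_design` is a proof of the summit, and every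
  refutation of the crux (`NoThresholdSubsetTriple`, crux 8302) refutes the stub (`not_design_of_noThreshold`).
* `design_volume_le_packing`: the `c = 0` wall — every design has level volume `≤ ((n+1)!)^{3/2}` (packing through
  `stub_push` + `stub_card`), so `0 < c` is load-bearing in the stub exactly as in the crux.
* The first quantitative DESIGN RULE, kernel-checked (census c3a §3 rule (L), used by every census of the line but
  not previously landed): `starPiece_tpp_of_levelCondition` (the level condition with non-empty lower sets forces the
  level-TPP of the three top star pieces), `card_inter_le_one_of_starPiece_tpp` (level-TPP star pieces have pairwise
  `|E_i ∩ E_j| ≤ 1`), `card_add_le_of_starPiece_tpp` (`|E₁|+|E₂|+|E₃| ≤ |α| + 3`), assembled for designs as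
  `design_top_card_add_le`: the three TOP direction sets of any design satisfy `|DA last|+|DB last|+|DC last| ≤ n+4`
  (so the top level carries at most `((n+4)/3)^3`, polynomial, of the required `((n+1)!)^{3/2}e^{-c√(n+1)}`; the
  threshold must be carried by the lower levels, where the same rule recurses only through `LevelCondition`).
  Exported verbatim as the registered stub `stub_designTopCapacity` of the crux item (end of file).

Sources: Cohn–Umans 2003 Def. 2.1 (TPP, tree `TripleProductProperty`); Blasiak–Church–Cohn–Grochow–Umans 2017
(arXiv:1712.02302) §5 (the subsets question this crux formalises); the line's card and censuses c3a/c3b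
(`Cruxes/ThresholdSubsetTriples/`).
-/

-- `Summit.<Summit>.<Problem>` is the tree's mandated summit-side namespace; for this single-conjunct summit the
-- two components coincide, so the file silences `dupNamespace` (same as the vocabulary file it imports).
set_option linter.dupNamespace false
set_option autoImplicit false

namespace Summit.MatrixMultiplication.MatrixMultiplication.Theorems.ThresholdSubsetTriples

namespace StubDesignReduction

open scoped Pointwise
open Literature.Combinatorics.Additive
open Summit.MatrixMultiplication.MatrixMultiplication.Theses.SnSubsetDichotomy

/-! ## 1. Chain classes: TPP = top level condition, volume = product of level volumes -/

/-- For three direction systems on `n+1` points, the triple product property of the chain classes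
`(subsig DA, subsig DB, subsig DC)` is EXACTLY the token-eliminated `LevelCondition` at the top token over the
three lower classes (assembled from the landed `subsig_succ`, `subsigBelow_apply_last` and `stub_push`). -/
theorem chainTPP_iff_levelCondition {n : ℕ} (DA DB DC : Fin (n + 1) → Finset (Fin (n + 1)))
    (hA : IsDirectionSystem DA) (hB : IsDirectionSystem DB) (hC : IsDirectionSystem DC) :
    TripleProductProperty (subsig DA) (subsig DB) (subsig DC) ↔
      LevelCondition (Fin.last n) (DA (Fin.last n)) (DB (Fin.last n)) (DC (Fin.last n))
        (subsigBelow DA n) (subsigBelow DB n) (subsigBelow DC n) := by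
  rw [subsig_succ DA, subsig_succ DB, subsig_succ DC]
  exact stub_push (Fin.last n) _ _ _ _ _ _ (subsigBelow_apply_last DA hA)
    (subsigBelow_apply_last DB hB) (subsigBelow_apply_last DC hC)

/-- The volume of a triple of chain classes is the product of the level volumes (landed `stub_card`, three
times, and `Finset.prod_mul_distrib`). -/
theorem chainVolume_eq {n : ℕ} (DA DB DC : Fin n → Finset (Fin n))
    (hA : IsDirectionSystem DA) (hB : IsDirectionSystem DB) (hC : IsDirectionSystem DC) :
    (subsig DA).card * (subsig DB).card * (subsig DC).card =
      ∏ k, ((DA k).card * (DB k).card * (DC k).card) := by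
  rw [stub_card DA hA, stub_card DB hB, stub_card DC hC, Finset.prod_mul_distrib,
    Finset.prod_mul_distrib]

/-! ## 2. The stub restated: `DESIGN` ↔ threshold chain-class TPP triples; `DESIGN → crux → summit` -/

/-- **What `stub_design` says.**  The registered stub (left) is verbatim equivalent to the existence, for every
`c > 0` and cofinally in `n`, of three direction systems whose CHAIN CLASSES form a TPP triple beating the
threshold `((n+1)!)^{3/2} e^{-c√(n+1)}` (right): the crux `ThresholdSubsetTriples` restricted to the chain-class
family. -/
theorem design_iff_chainThreshold :
    (∀ c : ℝ, 0 < c → ∀ n₀ : ℕ, ∃ n ≥ n₀, ∃ DA DB DC : Fin (n + 1) → Finset (Fin (n + 1)),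
      IsDirectionSystem DA ∧ IsDirectionSystem DB ∧ IsDirectionSystem DC ∧
      LevelCondition (Fin.last n) (DA (Fin.last n)) (DB (Fin.last n)) (DC (Fin.last n))
        (subsigBelow DA n) (subsigBelow DB n) (subsigBelow DC n) ∧
      ((n + 1).factorial : ℝ) ^ ((3 : ℝ) / 2) * Real.exp (-(c * Real.sqrt ((n + 1 : ℕ) : ℝ))) <
        ((∏ k : Fin (n + 1), ((DA k).card * (DB k).card * (DC k).card) : ℕ) : ℝ)) ↔
    (∀ c : ℝ, 0 < c → ∀ n₀ : ℕ, ∃ n ≥ n₀, ∃ DA DB DC : Fin (n + 1) → Finset (Fin (n + 1)),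
      IsDirectionSystem DA ∧ IsDirectionSystem DB ∧ IsDirectionSystem DC ∧
      TripleProductProperty (subsig DA) (subsig DB) (subsig DC) ∧
      ((n + 1).factorial : ℝ) ^ ((3 : ℝ) / 2) * Real.exp (-(c * Real.sqrt ((n + 1 : ℕ) : ℝ))) <
        (((subsig DA).card * (subsig DB).card * (subsig DC).card : ℕ) : ℝ)) := by
  refine forall_congr' fun c => imp_congr_right fun _ => forall_congr' fun n₀ => ?_
  refine exists_congr fun n => and_congr_right fun _ => ?_
  refine exists_congr fun DA => exists_congr fun DB => exists_congr fun DC => ?_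
  refine and_congr_right fun hA => and_congr_right fun hB => and_congr_right fun hC => ?_
  refine and_congr (chainTPP_iff_levelCondition DA DB DC hA hB hC).symm ?_
  rw [chainVolume_eq DA DB DC hA hB hC]

/-- **`DESIGN → crux`.**  A proof of the stub is a proof of `ThresholdSubsetTriples` (take the chain classes at
`n + 1 ≥ n₀` points): the landed lemmas reduce the CRUX to the STUB, never the stub to anything landed. -/
theorem thresholdSubsetTriples_of_design
    (hdesign : ∀ c : ℝ, 0 < c → ∀ n₀ : ℕ, ∃ n ≥ n₀, ∃ DA DB DC : Fin (n + 1) → Finset (Fin (n + 1)),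
      IsDirectionSystem DA ∧ IsDirectionSystem DB ∧ IsDirectionSystem DC ∧
      LevelCondition (Fin.last n) (DA (Fin.last n)) (DB (Fin.last n)) (DC (Fin.last n))
        (subsigBelow DA n) (subsigBelow DB n) (subsigBelow DC n) ∧
      ((n + 1).factorial : ℝ) ^ ((3 : ℝ) / 2) * Real.exp (-(c * Real.sqrt ((n + 1 : ℕ) : ℝ))) <
        ((∏ k : Fin (n + 1), ((DA k).card * (DB k).card * (DC k).card) : ℕ) : ℝ)) :
    ThresholdSubsetTriples := by
  intro c hc n₀
  obtain ⟨n, hn, DA, DB, DC, -, -, -, hT, hvol⟩ := design_iff_chainThreshold.1 hdesign c hc n₀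
  exact ⟨n + 1, le_trans hn (Nat.le_succ n), subsig DA, subsig DB, subsig DC, hT, hvol⟩

/-- **`DESIGN → summit`.**  Through the route's proved deciding theorem (`closes` with the proved Vershik–Kerov
bound, packaged as `Negative.matrixMultiplication_of_thresholdSubsetTriples`) a proof of `stub_design` is a proof
of `ω(ℂ) = 2`: the stub is summit-hard. -/
theorem matrixMultiplication_of_design
    (hdesign : ∀ c : ℝ, 0 < c → ∀ n₀ : ℕ, ∃ n ≥ n₀, ∃ DA DB DC : Fin (n + 1) → Finset (Fin (n + 1)),
      IsDirectionSystem DA ∧ IsDirectionSystem DB ∧ IsDirectionSystem DC ∧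
      LevelCondition (Fin.last n) (DA (Fin.last n)) (DB (Fin.last n)) (DC (Fin.last n))
        (subsigBelow DA n) (subsigBelow DB n) (subsigBelow DC n) ∧
      ((n + 1).factorial : ℝ) ^ ((3 : ℝ) / 2) * Real.exp (-(c * Real.sqrt ((n + 1 : ℕ) : ℝ))) <
        ((∏ k : Fin (n + 1), ((DA k).card * (DB k).card * (DC k).card) : ℕ) : ℝ)) :
    _root_.MatrixMultiplication :=
  Negative.matrixMultiplication_of_thresholdSubsetTriples (thresholdSubsetTriples_of_design hdesign)

/-- **Crux refutations kill the stub.**  The negative side `NoThresholdSubsetTriple` (crux 8302, `= ¬ crux`)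
refutes `DESIGN`. -/
theorem not_design_of_noThreshold (h : NoThresholdSubsetTriple) :
    ¬ (∀ c : ℝ, 0 < c → ∀ n₀ : ℕ, ∃ n ≥ n₀, ∃ DA DB DC : Fin (n + 1) → Finset (Fin (n + 1)),
      IsDirectionSystem DA ∧ IsDirectionSystem DB ∧ IsDirectionSystem DC ∧
      LevelCondition (Fin.last n) (DA (Fin.last n)) (DB (Fin.last n)) (DC (Fin.last n))
        (subsigBelow DA n) (subsigBelow DB n) (subsigBelow DC n) ∧
      ((n + 1).factorial : ℝ) ^ ((3 : ℝ) / 2) * Real.exp (-(c * Real.sqrt ((n + 1 : ℕ) : ℝ))) <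
        ((∏ k : Fin (n + 1), ((DA k).card * (DB k).card * (DC k).card) : ℕ) : ℝ)) :=
  fun hdesign => Negative.not_noThreshold_of_threshold (thresholdSubsetTriples_of_design hdesign) h

/-! ## 3. The `c = 0` wall: every design respects packing -/

/-- **Packing for designs.**  Whatever the direction systems, if the top level passes the level condition then
the level volume is at most `((n+1)!)^{3/2}`: the chain classes form a TPP triple (`chainTPP_iff_levelCondition`)
of volume equal to the level volume (`chainVolume_eq`), and TPP triples respect packing
(`dichotomyInduction_card_le_rpow`).  So the factor `e^{-c√(n+1)}`, `c > 0`, is what a design must fight for. -/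
theorem design_volume_le_packing {n : ℕ} (DA DB DC : Fin (n + 1) → Finset (Fin (n + 1)))
    (hA : IsDirectionSystem DA) (hB : IsDirectionSystem DB) (hC : IsDirectionSystem DC)
    (hL : LevelCondition (Fin.last n) (DA (Fin.last n)) (DB (Fin.last n)) (DC (Fin.last n))
      (subsigBelow DA n) (subsigBelow DB n) (subsigBelow DC n)) :
    ((∏ k : Fin (n + 1), ((DA k).card * (DB k).card * (DC k).card) : ℕ) : ℝ) ≤
      ((n + 1).factorial : ℝ) ^ ((3 : ℝ) / 2) := by
  rw [← chainVolume_eq DA DB DC hA hB hC]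
  exact Summit.MatrixMultiplication.MatrixMultiplication.Theorems.dichotomyInduction_card_le_rpow
    ((chainTPP_iff_levelCondition DA DB DC hA hB hC).2 hL)

/-! ## 4. Design rule (L): the top level of a design is three almost disjoint direction sets -/

section LevelRule

variable {α : Type*} [DecidableEq α] [Fintype α]

/-- **Rule (L), part 1.**  The level condition with NON-EMPTY lower sets forces the level-TPP of the three top
star pieces (specialise `LevelCondition` to trivial lower quotients `a = a'`, `b = b'`, `c = c'`). -/
theorem starPiece_tpp_of_levelCondition (t : α) (E₁ E₂ E₃ : Finset α)
    (L₁ L₂ L₃ : Finset (Equiv.Perm α)) (hL : LevelCondition t E₁ E₂ E₃ L₁ L₂ L₃)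
    (h₁ : L₁.Nonempty) (h₂ : L₂.Nonempty) (h₃ : L₃.Nonempty) :
    TripleProductProperty (starPiece E₁ t) (starPiece E₂ t) (starPiece E₃ t) := by
  obtain ⟨a, ha⟩ := h₁
  obtain ⟨b, hb⟩ := h₂
  obtain ⟨c, hc⟩ := h₃
  intro s hs s' hs' u hu u' hu' v hv v' hv' hrel
  obtain ⟨e₁, he₁, rfl⟩ := mem_starPiece.1 hs
  obtain ⟨e₁', he₁', rfl⟩ := mem_starPiece.1 hs'
  obtain ⟨e₂, he₂, rfl⟩ := mem_starPiece.1 hu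
  obtain ⟨e₂', he₂', rfl⟩ := mem_starPiece.1 hu'
  obtain ⟨e₃, he₃, rfl⟩ := mem_starPiece.1 hv
  obtain ⟨e₃', he₃', rfl⟩ := mem_starPiece.1 hv'
  have hrel' : Equiv.swap e₁ t * Equiv.swap ((a * a⁻¹) e₁') t * Equiv.swap ((a * a⁻¹) e₂) t
      * Equiv.swap ((a * a⁻¹ * (b * b⁻¹)) e₂') t * Equiv.swap ((a * a⁻¹ * (b * b⁻¹)) e₃) t
      * Equiv.swap ((a * a⁻¹ * (b * b⁻¹) * (c * c⁻¹)) e₃') t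
      * (a * a⁻¹ * (b * b⁻¹) * (c * c⁻¹)) = 1 := by
    simp only [mul_inv_cancel, mul_one, Equiv.Perm.coe_one, id_eq]
    simpa [Equiv.swap_inv, mul_assoc] using hrel
  obtain ⟨⟨k₁, -⟩, ⟨k₂, -⟩, ⟨k₃, -⟩⟩ :=
    hL e₁ he₁ e₁' he₁' e₂ he₂ e₂' he₂' e₃ he₃ e₃' he₃' a ha a ha b hb b hb c hc c hc hrel'
  exact ⟨by rw [k₁], by rw [k₂], by rw [k₃]⟩

/-- **Rule (L), part 2.**  Level-TPP star pieces (all three non-empty) have pairwise almost disjoint direction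
sets: `|E_i ∩ E_j| ≤ 1`.  Witness for `x ≠ y ∈ E₁ ∩ E₂`: `s = swap x t`, `s' = swap y t`, `u = swap y t`,
`u' = swap x t`, `v = v'` gives `s s'⁻¹ u u'⁻¹ v v'⁻¹ = 1` with `s ≠ s'`; similarly for the other two pairs. -/
theorem card_inter_le_one_of_starPiece_tpp (t : α) (E₁ E₂ E₃ : Finset α)
    (hT : TripleProductProperty (starPiece E₁ t) (starPiece E₂ t) (starPiece E₃ t))
    (h₁ : E₁.Nonempty) (h₂ : E₂.Nonempty) (h₃ : E₃.Nonempty) :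
    (E₁ ∩ E₂).card ≤ 1 ∧ (E₂ ∩ E₃).card ≤ 1 ∧ (E₁ ∩ E₃).card ≤ 1 := by
  obtain ⟨f₁, hf₁⟩ := h₁
  obtain ⟨f₂, hf₂⟩ := h₂
  obtain ⟨f₃, hf₃⟩ := h₃
  have mem : ∀ {E : Finset α} {x : α}, x ∈ E → Equiv.swap x t ∈ starPiece E t :=
    fun hx => mem_starPiece.2 ⟨_, hx, rfl⟩
  have inj : ∀ {x y : α}, Equiv.swap x t = Equiv.swap y t → x = y :=
    fun h => swap_left_injective t h
  have canc : ∀ x y z : α, Equiv.swap x t * (Equiv.swap y t)⁻¹ * (Equiv.swap y t * (Equiv.swap x t)⁻¹)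
      * (Equiv.swap z t * (Equiv.swap z t)⁻¹) = 1 := fun x y z => by
    simp [Equiv.swap_inv, mul_assoc, Equiv.swap_mul_self_mul, Equiv.swap_mul_self]
  have canc' : ∀ x y z : α, Equiv.swap z t * (Equiv.swap z t)⁻¹ * (Equiv.swap x t * (Equiv.swap y t)⁻¹)
      * (Equiv.swap y t * (Equiv.swap x t)⁻¹) = 1 := fun x y z => by
    simp [Equiv.swap_inv, mul_assoc, Equiv.swap_mul_self_mul, Equiv.swap_mul_self]
  have canc'' : ∀ x y z : α, Equiv.swap x t * (Equiv.swap y t)⁻¹ * (Equiv.swap z t * (Equiv.swap z t)⁻¹)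
      * (Equiv.swap y t * (Equiv.swap x t)⁻¹) = 1 := fun x y z => by
    simp [Equiv.swap_inv, mul_assoc, Equiv.swap_mul_self_mul, Equiv.swap_mul_self]
  refine ⟨Finset.card_le_one.2 fun x hx y hy => ?_, Finset.card_le_one.2 fun x hx y hy => ?_,
    Finset.card_le_one.2 fun x hx y hy => ?_⟩
  · obtain ⟨hx₁, hx₂⟩ := Finset.mem_inter.1 hx
    obtain ⟨hy₁, hy₂⟩ := Finset.mem_inter.1 hy
    exact inj (hT _ (mem hx₁) _ (mem hy₁) _ (mem hy₂) _ (mem hx₂) _ (mem hf₃) _ (mem hf₃)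
      (canc x y f₃)).1
  · obtain ⟨hx₂, hx₃⟩ := Finset.mem_inter.1 hx
    obtain ⟨hy₂, hy₃⟩ := Finset.mem_inter.1 hy
    exact inj (hT _ (mem hf₁) _ (mem hf₁) _ (mem hx₂) _ (mem hy₂) _ (mem hy₃) _ (mem hx₃)
      (canc' x y f₁)).2.1
  · obtain ⟨hx₁, hx₃⟩ := Finset.mem_inter.1 hx
    obtain ⟨hy₁, hy₃⟩ := Finset.mem_inter.1 hy
    exact inj (hT _ (mem hx₁) _ (mem hy₁) _ (mem hf₂) _ (mem hf₂) _ (mem hy₃) _ (mem hx₃)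
      (canc'' x y f₂)).1

/-- **Rule (L), part 3 (level capacity).**  Level-TPP star pieces at one token use at most `|α| + 3` directions
in total: `|E₁| + |E₂| + |E₃| ≤ |α| + 3` (inclusion–exclusion with pairwise intersections `≤ 1`). -/
theorem card_add_le_of_starPiece_tpp (t : α) (E₁ E₂ E₃ : Finset α)
    (hT : TripleProductProperty (starPiece E₁ t) (starPiece E₂ t) (starPiece E₃ t))
    (h₁ : E₁.Nonempty) (h₂ : E₂.Nonempty) (h₃ : E₃.Nonempty) :
    E₁.card + E₂.card + E₃.card ≤ Fintype.card α + 3 := by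
  obtain ⟨h12, h23, h13⟩ := card_inter_le_one_of_starPiece_tpp t E₁ E₂ E₃ hT h₁ h₂ h₃
  have hu12 := Finset.card_union_add_card_inter E₁ E₂
  have hu := Finset.card_union_add_card_inter (E₁ ∪ E₂) E₃
  have hsub : (E₁ ∪ E₂) ∩ E₃ ⊆ (E₁ ∩ E₃) ∪ (E₂ ∩ E₃) := by
    intro x hx
    simp only [Finset.mem_inter, Finset.mem_union] at hx ⊢
    tauto
  have h3 : ((E₁ ∪ E₂) ∩ E₃).card ≤ 2 :=
    (Finset.card_le_card hsub).trans ((Finset.card_union_le _ _).trans (by omega))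
  have htop : (E₁ ∪ E₂ ∪ E₃).card ≤ Fintype.card α := Finset.card_le_univ _
  omega

end LevelRule

/-- All lower classes of a direction system with non-empty levels are non-empty. -/
theorem subsigBelow_nonempty {n : ℕ} (D : Fin n → Finset (Fin n)) (hD : ∀ k, (D k).Nonempty) :
    ∀ m, (subsigBelow D m).Nonempty := by
  intro m
  induction m with
  | zero => exact ⟨1, by rw [subsigBelow_zero]; exact Finset.mem_singleton_self 1⟩
  | succ m ih =>
    rw [subsigBelow_succ]
    refine Finset.Nonempty.mul ?_ ih
    split_ifs with h
    · obtain ⟨d, hd⟩ := hD ⟨m, h⟩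
      exact ⟨_, mem_starPiece.2 ⟨d, hd, rfl⟩⟩
    · exact ⟨1, Finset.mem_singleton_self 1⟩

/-- A design beating any non-negative threshold has all its direction sets non-empty (an empty level kills the
level volume). -/
theorem levels_nonempty_of_lt_volume {n : ℕ} {DA DB DC : Fin (n + 1) → Finset (Fin (n + 1))} {x : ℝ}
    (hx : 0 ≤ x)
    (hvol : x < ((∏ k : Fin (n + 1), ((DA k).card * (DB k).card * (DC k).card) : ℕ) : ℝ)) :
    (∀ k, (DA k).Nonempty) ∧ (∀ k, (DB k).Nonempty) ∧ (∀ k, (DC k).Nonempty) := by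
  have hpos : (∏ k : Fin (n + 1), ((DA k).card * (DB k).card * (DC k).card)) ≠ 0 := by
    intro h0
    rw [h0, Nat.cast_zero] at hvol
    exact absurd hvol (not_lt.2 hx)
  have hk : ∀ k, (DA k).card * (DB k).card * (DC k).card ≠ 0 := fun k h0 =>
    hpos (Finset.prod_eq_zero (Finset.mem_univ k) h0)
  refine ⟨fun k => ?_, fun k => ?_, fun k => ?_⟩ <;>
  · rw [Finset.nonempty_iff_ne_empty]
    intro he
    apply hk k
    simp [he]

/-- **Design rule (L) at the top level, assembled.**  In every design (direction systems on `n+1` points whose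
top level passes `LevelCondition` over the lower classes and whose level volume beats a non-negative threshold)
the three top direction sets are pairwise almost disjoint, so together they use at most `n + 4` directions:
`|DA last| + |DB last| + |DC last| ≤ n + 4`.  (Top-level capacity `≤ ((n+4)/3)^3`: the threshold
`((n+1)!)^{3/2} e^{-c√(n+1)}` has to be carried by the levels below.) -/
theorem design_top_card_add_le {n : ℕ} (DA DB DC : Fin (n + 1) → Finset (Fin (n + 1)))
    (hL : LevelCondition (Fin.last n) (DA (Fin.last n)) (DB (Fin.last n)) (DC (Fin.last n))
      (subsigBelow DA n) (subsigBelow DB n) (subsigBelow DC n))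
    {x : ℝ} (hx : 0 ≤ x)
    (hvol : x < ((∏ k : Fin (n + 1), ((DA k).card * (DB k).card * (DC k).card) : ℕ) : ℝ)) :
    (DA (Fin.last n)).card + (DB (Fin.last n)).card + (DC (Fin.last n)).card ≤ n + 4 := by
  obtain ⟨hA, hB, hC⟩ := levels_nonempty_of_lt_volume hx hvol
  have hT := starPiece_tpp_of_levelCondition (Fin.last n) _ _ _ _ _ _ hL
    (subsigBelow_nonempty DA hA n) (subsigBelow_nonempty DB hB n) (subsigBelow_nonempty DC hC n)
  have h := card_add_le_of_starPiece_tpp (Fin.last n) _ _ _ hT (hA _) (hB _) (hC _)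
  rw [Fintype.card_fin] at h
  omega

end StubDesignReduction

/-- **Registered stub `stub_designTopCapacity` (design rule (L) at the top level, siege k11).**  In every design of
the line — direction systems `DA DB DC` on `n+1` points whose top level passes `LevelCondition` over the three lower
chain classes and whose level volume `∏_k |DA k|·|DB k|·|DC k|` beats some non-negative threshold — the three TOP
direction sets are pairwise almost disjoint and use at most `n + 4` directions in total:
`|DA last| + |DB last| + |DC last| ≤ n + 4` (so the top level carries at most `((n+4)/3)^3` of the volume).
Assembled from the landed `stub_push` vocabulary via `StubDesignReduction.design_top_card_add_le`. -/
theorem stub_designTopCapacity : ∀ (n : ℕ) (DA DB DC : Fin (n + 1) → Finset (Fin (n + 1))), LevelCondition (Fin.last n) (DA (Fin.last n)) (DB (Fin.last n)) (DC (Fin.last n)) (subsigBelow DA n) (subsigBelow DB n) (subsigBelow DC n) → ∀ x : ℝ, 0 ≤ x → x < ((∏ k : Fin (n + 1), ((DA k).card * (DB k).card * (DC k).card) : ℕ) : ℝ) → (DA (Fin.last n)).card + (DB (Fin.last n)).card + (DC (Fin.last n)).card ≤ n + 4 :=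
  fun _ DA DB DC hL _ hx hvol => StubDesignReduction.design_top_card_add_le DA DB DC hL hx hvol

end Summit.MatrixMultiplication.MatrixMultiplication.Theorems.ThresholdSubsetTriples
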